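import Summits.QuantumFields.YangMills.Theorems.FemtoTransferGapRungW1upSite

/-!
# Femto transfer gap — the adjoint-action dictionary, I: quaternion parts and the adjoint rotation

Support module of the `FemtoTransferGap` group (cell `ym-beyond`, seat P1; route `LuscherReduction`, crux `OneSiteLevels` =
`stmt-QuantumFields-20007`).  With its sequel `FemtoTransferGapZeroModes` it supplies, sorry-free, the DICTIONARY that both open
energy stubs of the crux (`stub_absUpper` / `stub_absLower`: `|E₁^phys(B,1) − λ_b ε₁| ≤ C λ_b²`) consume when a zero-mode trial
function or eigenfunction of `𝔥 = −½Δ + V` on `ℝ⁹` (tree: `Literature.Analysis.OperatorTheory.YMMatrixModel` — coordinates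
`ZM = ℝ^{3×3}`, potential `luscherPotential`, colour rotations `colourRotate R`, `IsGaugeInv`) is pulled back to the three links of
the one-site lattice.  This file:

* §1 the scalar / vector (unit-quaternion) parts `scalarPart U = re`, `vecPart U = (imI, imJ, imK)` of `U ∈ SU(2)` on the tree's
  quaternion model `su2Quat` (`Literature/…/QuantumLattice/SU2Haar`): `u₀² + |u|² = 1`, `‖U ∓ 1‖_F² = 4(1 ∓ u₀)`,
  `|u|² ≤ vacDist(U)²/2`, the centre `−1` flips both, continuity;
* §2 the EXPLICIT adjoint rotation `adRot V ∈ SO(3)` (the quadratic unit-quaternion parametrisation of `SO(3)`), the equivariance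
  `vecPart (V U V⁻¹) = adRot V · vecPart U` and `scalarPart (V U V⁻¹) = scalarPart U` (polynomial identities in the entries), and
  the tree's exact commutator identity in cross-product form `2 − Re tr(A B A⁻¹ B⁻¹) = 4 |u_A × u_B|²`
  (`two_sub_re_trace_comm_eq_cross`, a corollary of `two_sub_re_trace_comm_eq`);
* §2b the inverse chart `chartSU2 u = quatToSU2 (√(1−|u|²), u)` (tree: `quatToSU2`): `vecPart (chartSU2 u) = u` and
  `scalarPart (chartSU2 u) = √(1−|u|²)` for `|u| ≤ 1`, `chartSU2 (vecPart U) = U` on the hemisphere `u₀ ≥ 0` (`‖U − 1‖_F² ≤ 4`), continuity.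

## WHAT THIS IS NOT
Not a proof of either energy stub and NOT THE CLAY GAP: finite-dimensional (`L = 1`) matrix algebra, no limit, no spectral
statement.  Everything below is proved (no `sorry`, no new axiom).
-/

set_option autoImplicit false

noncomputable section

open MeasureTheory Filter Topology Real
open scoped Matrix ComplexConjugate Quaternion
open Literature.MathematicalPhysics.QuantumFieldTheory
open Literature.MathematicalPhysics.QuantumLattice
open Literature.Analysis.OperatorTheory.YMMatrixModel

namespace Summit.QuantumFields.YangMills.Theorems.FemtoTransferGap

/-! ### §1. Scalar and vector parts on the quaternion model `su2Quat` -/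

/-- `V V^* = 1` for `V ∈ SU(2)`. [folklore] -/
theorem su2_mul_star (V : SU2) : (V : Matrix (Fin 2) (Fin 2) ℂ) * star (V : Matrix (Fin 2) (Fin 2) ℂ) = 1 :=
  Matrix.mem_unitaryGroup_iff.1 (su2_mem_unitaryGroup V)

/-- The inverse is the adjoint: `↑(V⁻¹) = V^*`. [folklore] -/
theorem coe_inv_eq_star (V : SU2) : ((V⁻¹ : SU2) : Matrix (Fin 2) (Fin 2) ℂ) = star (V : Matrix (Fin 2) (Fin 2) ℂ) := by
  have h1 : ((V⁻¹ * V : SU2) : Matrix (Fin 2) (Fin 2) ℂ) = 1 := by rw [inv_mul_cancel]; rfl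
  rw [Submonoid.coe_mul] at h1
  calc ((V⁻¹ : SU2) : Matrix (Fin 2) (Fin 2) ℂ)
      = ((V⁻¹ : SU2) : Matrix (Fin 2) (Fin 2) ℂ) * ((V : Matrix (Fin 2) (Fin 2) ℂ) * star (V : Matrix (Fin 2) (Fin 2) ℂ)) := by
        rw [su2_mul_star, mul_one]
    _ = star (V : Matrix (Fin 2) (Fin 2) ℂ) := by rw [← mul_assoc, h1, one_mul]

/-- `|a|² + |b|² = 1` in real form: `re² + imI² + imJ² + imK² = 1` for the first row of `V ∈ SU(2)`. [folklore] -/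
theorem su2_sq_sum (V : SU2) : ((V : Matrix (Fin 2) (Fin 2) ℂ) 0 0).re ^ 2 + ((V : Matrix (Fin 2) (Fin 2) ℂ) 0 0).im ^ 2 +
    ((V : Matrix (Fin 2) (Fin 2) ℂ) 0 1).re ^ 2 + ((V : Matrix (Fin 2) (Fin 2) ℂ) 0 1).im ^ 2 = 1 := by
  have h := normSq_su2Quat V
  rw [Quaternion.normSq_def'] at h
  simpa [su2Quat] using h

/-- The scalar (quaternion real) part `u₀ = Re a = ½ Re tr U`. [cite: BrockerTomDieck1985, I (1.10)] -/
def scalarPart (U : SU2) : ℝ := (su2Quat U).re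

/-- The vector part `u = (imI, imJ, imK) = (Im a, Re b, Im b) ∈ ℝ³`. [cite: BrockerTomDieck1985, I (1.10)] -/
def vecPart (U : SU2) : Fin 3 → ℝ := ![(su2Quat U).imI, (su2Quat U).imJ, (su2Quat U).imK]

/-- `u₀ = Re U₀₀`. [folklore] -/
theorem scalarPart_eq (U : SU2) : scalarPart U = ((U : Matrix (Fin 2) (Fin 2) ℂ) 0 0).re := rfl

/-- `u_0 = Im U₀₀` (coefficient of `iσ₃` in the physicists' basis, `i` in `ℍ`). [folklore] -/
@[simp] theorem vecPart_zero (U : SU2) : vecPart U 0 = ((U : Matrix (Fin 2) (Fin 2) ℂ) 0 0).im := rfl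

/-- `u_1 = Re U₀₁` (`j` in `ℍ`). [folklore] -/
@[simp] theorem vecPart_one (U : SU2) : vecPart U 1 = ((U : Matrix (Fin 2) (Fin 2) ℂ) 0 1).re := rfl

/-- `u_2 = Im U₀₁` (`k` in `ℍ`). [folklore] -/
@[simp] theorem vecPart_two (U : SU2) : vecPart U 2 = ((U : Matrix (Fin 2) (Fin 2) ℂ) 0 1).im := rfl

/-- `Re tr U = 2 u₀` (the tree's `su2_trace_re_eq_quat`). [cite: BrockerTomDieck1985, I (1.10)] -/
theorem re_trace_eq_two_mul_scalarPart (U : SU2) : ((U : Matrix (Fin 2) (Fin 2) ℂ).trace).re = 2 * scalarPart U :=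
  su2_trace_re_eq_quat U

/-- `u₀² + |u|² = 1`. [folklore] -/
theorem scalarPart_sq_add (U : SU2) : scalarPart U ^ 2 + ∑ a, vecPart U a ^ 2 = 1 := by
  rw [Fin.sum_univ_three]
  simp only [vecPart_zero, vecPart_one, vecPart_two, scalarPart_eq]
  have h := su2_sq_sum U
  linarith

/-- `|u|² = 1 − u₀²`. [folklore] -/
theorem sum_vecPart_sq (U : SU2) : ∑ a, vecPart U a ^ 2 = 1 - scalarPart U ^ 2 := by
  have h := scalarPart_sq_add U; linarith

/-- `|u|² = u ⬝ᵥ u`. [folklore] -/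
theorem vecPart_dot_self (U : SU2) : vecPart U ⬝ᵥ vecPart U = ∑ a, vecPart U a ^ 2 :=
  Finset.sum_congr rfl fun b _ => (sq (vecPart U b)).symm

/-- `|u₀| ≤ 1`. [folklore] -/
theorem abs_scalarPart_le (U : SU2) : |scalarPart U| ≤ 1 := by
  have h := sum_vecPart_sq U
  have h0 : 0 ≤ ∑ a, vecPart U a ^ 2 := Finset.sum_nonneg fun a _ => sq_nonneg _
  have hs : scalarPart U ^ 2 ≤ 1 := by linarith
  exact (sq_le_one_iff_abs_le_one _).1 hs

/-- `|u|² ≤ 1`. [folklore] -/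
theorem sum_vecPart_sq_le (U : SU2) : ∑ a, vecPart U a ^ 2 ≤ 1 := by
  rw [sum_vecPart_sq]; nlinarith [sq_nonneg (scalarPart U)]

/-- `‖U − 1‖_F² = 4(1 − u₀)`. [folklore] -/
theorem frobNorm_sub_one_sq_eq_scalarPart (U : SU2) :
    frobNorm ((U : Matrix (Fin 2) (Fin 2) ℂ) - 1) ^ 2 = 4 * (1 - scalarPart U) := by
  rw [frobNorm_sub_one_sq, re_trace_eq_two_mul_scalarPart]; ring

/-- `‖U + 1‖_F² = 4(1 + u₀)`. [folklore] -/
theorem frobNorm_add_one_sq_eq_scalarPart (U : SU2) :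
    frobNorm ((U : Matrix (Fin 2) (Fin 2) ℂ) + 1) ^ 2 = 4 * (1 + scalarPart U) := by
  rw [frobNorm_add_one_sq, re_trace_eq_two_mul_scalarPart]; ring

/-- Near the vacuum the vector part is the whole deviation up to fourth order: `|u|² ≤ ‖U − 1‖_F²/2` (`1 − u₀² ≤ 2(1 − u₀)`).
[folklore] -/
theorem sum_vecPart_sq_le_frobNorm_sub_one_sq (U : SU2) :
    ∑ a, vecPart U a ^ 2 ≤ frobNorm ((U : Matrix (Fin 2) (Fin 2) ℂ) - 1) ^ 2 / 2 := by
  rw [sum_vecPart_sq, frobNorm_sub_one_sq_eq_scalarPart]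
  have h := abs_scalarPart_le U
  rw [abs_le] at h
  nlinarith [h.1, h.2]

/-- … and symmetrically `|u|² ≤ ‖U + 1‖_F²/2`, whence `|u|² ≤ vacDist(U)²/2`. [folklore] -/
theorem sum_vecPart_sq_le_vacDist_sq (U : SU2) : ∑ a, vecPart U a ^ 2 ≤ vacDist U ^ 2 / 2 := by
  have h := abs_scalarPart_le U
  rw [abs_le] at h
  have h1 : ∑ a, vecPart U a ^ 2 ≤ frobNorm ((U : Matrix (Fin 2) (Fin 2) ℂ) - 1) ^ 2 / 2 :=
    sum_vecPart_sq_le_frobNorm_sub_one_sq U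
  have h2 : ∑ a, vecPart U a ^ 2 ≤ frobNorm ((U : Matrix (Fin 2) (Fin 2) ℂ) + 1) ^ 2 / 2 := by
    rw [sum_vecPart_sq, frobNorm_add_one_sq_eq_scalarPart]; nlinarith [h.1, h.2]
  unfold vacDist
  rcases min_cases (frobNorm ((U : Matrix (Fin 2) (Fin 2) ℂ) - 1)) (frobNorm ((U : Matrix (Fin 2) (Fin 2) ℂ) + 1)) with
    ⟨hm, _⟩ | ⟨hm, _⟩ <;> rw [hm] <;> assumption

/-- Under the centre: `scalarPart(−U) = −u₀`. [folklore] -/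
theorem scalarPart_negOne_mul (U : SU2) : scalarPart (negOne * U) = -scalarPart U := by
  simp [scalarPart_eq]

/-- Under the centre: `vecPart(−U) = −u`. [folklore] -/
theorem vecPart_negOne_mul (U : SU2) : vecPart (negOne * U) = -vecPart U := by
  ext a
  fin_cases a <;> simp

/-- The entry maps are continuous. [folklore] -/
theorem continuous_su2_apply (i j : Fin 2) : Continuous fun U : SU2 => (U : Matrix (Fin 2) (Fin 2) ℂ) i j :=
  (continuous_apply_apply i j).comp continuous_subtype_val

/-- `scalarPart` is continuous. [folklore] -/
theorem continuous_scalarPart : Continuous scalarPart :=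
  Complex.continuous_re.comp (continuous_su2_apply 0 0)

/-- `vecPart` is continuous. [folklore] -/
theorem continuous_vecPart : Continuous vecPart := by
  refine continuous_pi fun a => ?_
  fin_cases a
  · exact Complex.continuous_im.comp (continuous_su2_apply 0 0)
  · exact Complex.continuous_re.comp (continuous_su2_apply 0 1)
  · exact Complex.continuous_im.comp (continuous_su2_apply 0 1)

/-! ### §2. The adjoint rotation `Ad(V) ∈ SO(3)`: `vecPart(V U V⁻¹) = Ad(V)·vecPart(U)` -/

/-- The adjoint rotation of `V = [[p+iq, r+is], [−r+is, p−iq]]` on the vector part `(imI, imJ, imK)`: the classical quadratic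
parametrisation of `SO(3)` by unit quaternions. [cite: BrockerTomDieck1985, I (1.10)] [cite: Sepanski2007, §1.1.4] -/
def adRot (V : SU2) : Matrix (Fin 3) (Fin 3) ℝ :=
  let p := ((V : Matrix (Fin 2) (Fin 2) ℂ) 0 0).re
  let q := ((V : Matrix (Fin 2) (Fin 2) ℂ) 0 0).im
  let r := ((V : Matrix (Fin 2) (Fin 2) ℂ) 0 1).re
  let s := ((V : Matrix (Fin 2) (Fin 2) ℂ) 0 1).im
  !![p ^ 2 + q ^ 2 - r ^ 2 - s ^ 2, 2 * (q * r - p * s), 2 * (q * s + p * r);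
     2 * (q * r + p * s), p ^ 2 - q ^ 2 + r ^ 2 - s ^ 2, 2 * (r * s - p * q);
     2 * (q * s - p * r), 2 * (p * q + r * s), p ^ 2 - q ^ 2 - r ^ 2 + s ^ 2]

/-- `Ad(V)` is orthogonal: `Ad(V)ᵀ Ad(V) = 1` (uses `|a|² + |b|² = 1`). [cite: BrockerTomDieck1985, I (1.10)] -/
theorem adRot_transpose_mul_self (V : SU2) : (adRot V)ᵀ * adRot V = 1 := by
  have h := su2_sq_sum V
  set p := ((V : Matrix (Fin 2) (Fin 2) ℂ) 0 0).re
  set q := ((V : Matrix (Fin 2) (Fin 2) ℂ) 0 0).im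
  set r := ((V : Matrix (Fin 2) (Fin 2) ℂ) 0 1).re
  set s := ((V : Matrix (Fin 2) (Fin 2) ℂ) 0 1).im
  have h2 : (p ^ 2 + q ^ 2 + r ^ 2 + s ^ 2) ^ 2 = 1 := by rw [h]; norm_num
  ext i j
  fin_cases i <;> fin_cases j <;>
    simp [adRot, Matrix.mul_apply, Matrix.transpose_apply, Fin.sum_univ_three] <;> nlinarith [h2]

/-- `det Ad(V) = 1`. [cite: BrockerTomDieck1985, I (1.10)] -/
theorem det_adRot (V : SU2) : (adRot V).det = 1 := by
  have h := su2_sq_sum V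
  set p := ((V : Matrix (Fin 2) (Fin 2) ℂ) 0 0).re
  set q := ((V : Matrix (Fin 2) (Fin 2) ℂ) 0 0).im
  set r := ((V : Matrix (Fin 2) (Fin 2) ℂ) 0 1).re
  set s := ((V : Matrix (Fin 2) (Fin 2) ℂ) 0 1).im
  have h3 : (p ^ 2 + q ^ 2 + r ^ 2 + s ^ 2) ^ 3 = 1 := by rw [h]; norm_num
  rw [Matrix.det_fin_three]
  simp [adRot]
  nlinarith [h3]

/-- `Ad(V) ∈ SO(3)`. [cite: BrockerTomDieck1985, I (1.10)] -/
theorem adRot_mem_specialOrthogonalGroup (V : SU2) : adRot V ∈ Matrix.specialOrthogonalGroup (Fin 3) ℝ := by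
  rw [Matrix.mem_specialOrthogonalGroup_iff]
  refine ⟨?_, det_adRot V⟩
  rw [Matrix.mem_orthogonalGroup_iff']
  simpa [Matrix.star_eq_conjTranspose] using adRot_transpose_mul_self V

/-- **Equivariance**: `vecPart(V U V⁻¹) = Ad(V)·vecPart(U)` — conjugation acts on the vector part by the adjoint rotation
(a polynomial identity in the entries). [cite: BrockerTomDieck1985, I (1.10)] [cite: Sepanski2007, §1.1.4] -/
theorem vecPart_conj (V U : SU2) : vecPart (V * U * V⁻¹) = (adRot V).mulVec (vecPart U) := by
  have hU11 := su2_apply_11 U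
  have hU10 := su2_apply_10 U
  have hV11 := su2_apply_11 V
  have hV10 := su2_apply_10 V
  have hcoe : ((V * U * V⁻¹ : SU2) : Matrix (Fin 2) (Fin 2) ℂ) =
      (V : Matrix (Fin 2) (Fin 2) ℂ) * (U : Matrix (Fin 2) (Fin 2) ℂ) * star (V : Matrix (Fin 2) (Fin 2) ℂ) := by
    rw [Submonoid.coe_mul, Submonoid.coe_mul, coe_inv_eq_star]
  ext a
  fin_cases a <;>
    simp [vecPart, su2Quat, adRot, Matrix.mulVec, dotProduct, Fin.sum_univ_three, hcoe, Matrix.mul_apply, Fin.sum_univ_two,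
      Matrix.star_apply, hU11, hU10, hV11, hV10, Complex.mul_re, Complex.mul_im, Complex.add_re, Complex.add_im] <;> ring

/-- The scalar part is a class function: `scalarPart(V U V⁻¹) = scalarPart(U)`. [folklore] -/
theorem scalarPart_conj (V U : SU2) : scalarPart (V * U * V⁻¹) = scalarPart U := by
  have h1 := re_trace_eq_two_mul_scalarPart (V * U * V⁻¹)
  have h2 := re_trace_eq_two_mul_scalarPart U
  have h : ((V * U * V⁻¹ : SU2) : Matrix (Fin 2) (Fin 2) ℂ).trace = (U : Matrix (Fin 2) (Fin 2) ℂ).trace := by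
    rw [Submonoid.coe_mul, Submonoid.coe_mul, Matrix.trace_mul_cycle, ← Submonoid.coe_mul, inv_mul_cancel]
    simp
  rw [h] at h1
  linarith

/-- `|u × u|² = 0`. [folklore] -/
theorem cross_dot_cross_self (u : Fin 3 → ℝ) : (u ⨯₃ u) ⬝ᵥ (u ⨯₃ u) = 0 := by
  rw [cross_self]; simp

/-- The tree's exact commutator identity in cross-product form: `2 − Re tr(A B A⁻¹ B⁻¹) = 4 |u_A × u_B|²`.
[cite: Luscher1983, §2] [cite: BrockerTomDieck1985, I (1.10)] -/
theorem two_sub_re_trace_comm_eq_cross (A B : SU2) :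
    2 - (((A * B * A⁻¹ * B⁻¹ : SU2) : Matrix (Fin 2) (Fin 2) ℂ).trace).re =
      4 * ((vecPart A ⨯₃ vecPart B) ⬝ᵥ (vecPart A ⨯₃ vecPart B)) := by
  rw [two_sub_re_trace_comm_eq]
  simp only [cross_apply, dotProduct, Fin.sum_univ_three, vecPart, Matrix.cons_val_zero, Matrix.cons_val_one, Matrix.head_cons,
    Matrix.cons_val_two, Matrix.tail_cons]
  ring

/-! ### §2b. The inverse chart: vector coordinates ↦ group elements (`u ↦ (√(1−|u|²), u) ∈ S³ → SU(2)`) -/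

/-- The quaternion `(√(1 − |u|²), u₀, u₁, u₂)` of a vector `u ∈ ℝ³` (unit norm when `|u| ≤ 1`). [folklore] -/
def chartQuat (u : Fin 3 → ℝ) : ℍ := ⟨√(1 - ∑ a, u a ^ 2), u 0, u 1, u 2⟩

/-- The quaternion chart of the upper hemisphere: `chartSU2 u = quatToSU2 (√(1 − |u|²), u)`. [cite: BrockerTomDieck1985, I (1.10)] -/
def chartSU2 (u : Fin 3 → ℝ) : SU2 := quatToSU2 (chartQuat u)

/-- `|chartQuat u|² = 1` for `|u| ≤ 1`. [folklore] -/
theorem normSq_chartQuat {u : Fin 3 → ℝ} (hu : ∑ a, u a ^ 2 ≤ 1) : Quaternion.normSq (chartQuat u) = 1 := by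
  rw [Quaternion.normSq_def']
  simp only [chartQuat]
  rw [Real.sq_sqrt (by linarith), Fin.sum_univ_three]
  ring

/-- `‖chartQuat u‖ = 1` for `|u| ≤ 1`. [folklore] -/
theorem norm_chartQuat {u : Fin 3 → ℝ} (hu : ∑ a, u a ^ 2 ≤ 1) : ‖chartQuat u‖ = 1 := by
  have h := normSq_chartQuat hu
  rw [Quaternion.normSq_eq_norm_mul_self] at h
  nlinarith [norm_nonneg (chartQuat u)]

/-- `chartQuat u ≠ 0` for every `u` (unit norm inside the ball, non-zero vector part outside). [folklore] -/
theorem chartQuat_ne_zero (u : Fin 3 → ℝ) : chartQuat u ≠ 0 := by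
  intro h
  by_cases hu : ∑ a, u a ^ 2 ≤ 1
  · have := norm_chartQuat hu
    rw [h, norm_zero] at this
    exact zero_ne_one this
  · have h0 : u 0 = 0 := by simpa [chartQuat] using congrArg (fun q : ℍ => q.imI) h
    have h1 : u 1 = 0 := by simpa [chartQuat] using congrArg (fun q : ℍ => q.imJ) h
    have h2 : u 2 = 0 := by simpa [chartQuat] using congrArg (fun q : ℍ => q.imK) h
    apply hu
    rw [Fin.sum_univ_three, h0, h1, h2]
    norm_num

/-- The matrix of the chart: `chartSU2 u = quatMatrix (chartQuat u)` for `|u| ≤ 1`. [folklore] -/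
theorem coe_chartSU2 {u : Fin 3 → ℝ} (hu : ∑ a, u a ^ 2 ≤ 1) :
    (chartSU2 u : Matrix (Fin 2) (Fin 2) ℂ) = quatMatrix (chartQuat u) :=
  coe_quatToSU2_of_norm_eq_one (norm_chartQuat hu)

/-- `su2Quat (chartSU2 u) = chartQuat u` for `|u| ≤ 1`. [folklore] -/
theorem su2Quat_chartSU2 {u : Fin 3 → ℝ} (hu : ∑ a, u a ^ 2 ≤ 1) : su2Quat (chartSU2 u) = chartQuat u := by
  ext <;> simp [su2Quat, coe_chartSU2 hu, chartQuat]

/-- **The chart inverts the vector part**: `vecPart (chartSU2 u) = u` for `|u| ≤ 1`. [cite: BrockerTomDieck1985, I (1.10)] -/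
theorem vecPart_chartSU2 {u : Fin 3 → ℝ} (hu : ∑ a, u a ^ 2 ≤ 1) : vecPart (chartSU2 u) = u := by
  ext a
  fin_cases a <;> simp [vecPart, su2Quat_chartSU2 hu, chartQuat]

/-- `scalarPart (chartSU2 u) = √(1 − |u|²)` for `|u| ≤ 1` (the chart covers the hemisphere `u₀ ≥ 0`). [folklore] -/
theorem scalarPart_chartSU2 {u : Fin 3 → ℝ} (hu : ∑ a, u a ^ 2 ≤ 1) : scalarPart (chartSU2 u) = √(1 - ∑ a, u a ^ 2) := by
  simp [scalarPart, su2Quat_chartSU2 hu, chartQuat]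

/-- **Local inverse**: on the hemisphere `u₀ ≥ 0` (i.e. `‖U − 1‖_F ≤ 2`), `chartSU2 (vecPart U) = U`. [cite: BrockerTomDieck1985, I (1.10)] -/
theorem chartSU2_vecPart (U : SU2) (h : 0 ≤ scalarPart U) : chartSU2 (vecPart U) = U := by
  have hq : chartQuat (vecPart U) = su2Quat U := by
    have hs : √(1 - ∑ a, vecPart U a ^ 2) = scalarPart U := by
      rw [sum_vecPart_sq, sub_sub_cancel, Real.sqrt_sq h]
    ext
    · simpa [chartQuat, scalarPart] using hs
    · simp [chartQuat, vecPart]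
    · simp [chartQuat, vecPart]
    · simp [chartQuat, vecPart]
  rw [chartSU2, hq, quatToSU2_su2Quat]

/-- The hemisphere condition in Frobenius terms: `0 ≤ u₀ ↔ ‖U − 1‖_F² ≤ 4`. [folklore] -/
theorem scalarPart_nonneg_iff (U : SU2) : 0 ≤ scalarPart U ↔ frobNorm ((U : Matrix (Fin 2) (Fin 2) ℂ) - 1) ^ 2 ≤ 4 := by
  rw [frobNorm_sub_one_sq_eq_scalarPart]; constructor <;> intro h <;> linarith

/-- `chartQuat` in the algebra basis `1, i, j, k`. [folklore] -/
theorem chartQuat_eq (u : Fin 3 → ℝ) : chartQuat u = (√(1 - ∑ a, u a ^ 2) : ℍ) + (u 0 : ℍ) * ⟨0, 1, 0, 0⟩ +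
    (u 1 : ℍ) * ⟨0, 0, 1, 0⟩ + (u 2 : ℍ) * ⟨0, 0, 0, 1⟩ := by
  ext <;> simp [chartQuat]

/-- `chartQuat` is continuous. [folklore] -/
theorem continuous_chartQuat : Continuous chartQuat := by
  have hs : Continuous fun u : Fin 3 → ℝ => √(1 - ∑ a, u a ^ 2) :=
    Real.continuous_sqrt.comp (continuous_const.sub (continuous_finsetSum _ fun a _ => (continuous_apply a).pow 2))
  have h : Continuous fun u : Fin 3 → ℝ => (√(1 - ∑ a, u a ^ 2) : ℍ) + (u 0 : ℍ) * ⟨0, 1, 0, 0⟩ +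
      (u 1 : ℍ) * ⟨0, 0, 1, 0⟩ + (u 2 : ℍ) * ⟨0, 0, 0, 1⟩ :=
    (((Quaternion.continuous_coe.comp hs).add ((Quaternion.continuous_coe.comp (continuous_apply 0)).mul continuous_const)).add
      ((Quaternion.continuous_coe.comp (continuous_apply 1)).mul continuous_const)).add
      ((Quaternion.continuous_coe.comp (continuous_apply 2)).mul continuous_const)
  exact h.congr fun u => (chartQuat_eq u).symm

/-- `chartSU2` is continuous (everywhere: `chartQuat` never vanishes). [folklore] -/
theorem continuous_chartSU2 : Continuous chartSU2 :=
  continuousOn_quatToSU2.comp_continuous continuous_chartQuat fun u => chartQuat_ne_zero u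


end Summit.QuantumFields.YangMills.Theorems.FemtoTransferGap

end
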